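import Summits.ABC.IUTFork.Charitable.Thm311D3
import Summits.ABC.IUTFork.Charitable.Thm311D3DeriveKit
import HarnessLib

/-!
# [IUTchIII] Thm 3.11, charitable re-typing D3 — what the maximal reading FORCES on volumes (team D3, abc-iut-D3-prv; sequel to p431653)

Proof-only file (D-0012; NO definition, NO `Prop` fact) of the abc-iut cell, BLOCK D team D3 (rung LADDER-ABC:A2.D). TAKES NO SIDE on
[IUTchIII] Cor. 3.12 or on any author. One kernel datum for the D referees' (c) question («is team D3's charitable reading FAITHFUL or
STRONGER-THAN-PRINT?»), obtained by composing deliverable (a) (`D3Derive.s_of_charitable_3`, p431653 — its route-R1 term is inlined here so that this file imports only the typing and the kit) with abc-iut-w4-d021's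
`Cor312Vol.candidate_forces_equal_volumes` (Cor312PinnedCandidateProtocol) / abc-iut-w4-d103's `PinnedHonest.logvol_qRegion_eq_of_reading3`
(p418630):

* `charitable_3_forces_equal_volumes` — under the three pins, D3-typ's OWN print-faithful isometry clause `D3.IndIsometric` ((Ind1),(Ind2)
  are isometries of the log-shells: Thm 3.11 (i)(a) p. 153 l. 40–43 with Prop 3.9 (i)(ii); [IUTchII] Ex. 1.8 (iv)) and admissible
  (Ind3)-regions, the maximal reading `Thm311Charitable_3` forces, in EVERY packet `(j, v_ℚ)`, EQUALITY of the log-volume of the q-pilot's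
  Kummer-image region `ρ qK` and of the Θ-pilot's column Kummer-image region `ρ Ψ_n`. Print computes these two volumes as `−|log(q)|`-type
  and `−j²·|log(q)|`-type quantities respectively ([IUTchIV] Thm 1.10 Step (v); Rmk 3.11.1 (i) p. 159 l. 10–13 «the theta values
  {q^{j²}}»), so the maximal reading is consistent only with models in which that computation degenerates (`j² = 1` volumes) — the kernel
  form of «charity at the identification level costs the `j²`». Under the pins this volume identity is also what Team R's identified-copies
  reading produces ([cite: ScholzeStix2018, §2.2 pp. 9–10]); abc-iut-w5-d230's P♮ (`charitable_3_holds_at_natSetting`, p431653) shows the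
  identity can hold WITHOUT identification of the regions.
* `charitable_3_qLocal_eq` — the same stated on the Setting's printed local quantity `qLocal` (Cor 3.12 p. 174 l. 5–9) against the
  (Ind3)-enlarged Θ-region `thetaRegion3` (p. 174 l. 2–4).
S. Mochizuki, *Inter-universal Teichmüller theory III*, pp. 153–159, 173–174, 181–184 [claim: Mochizuki2012, status: disputed]. Typed ≠ proved;
derived-under-a-reading ≠ endorsed; no side taken.
-/

noncomputable section

open Set

namespace Summit.ABC.IUTFork.Charitable.D3DeriveVolumes

open Thm311 Cor312 Cor312Vol Literature.IUT.LogThetaLattice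

variable {T : ThetaIndex} (S : LatticeSituation T) (P : Cor312.Setting S.toSituation)
  (ρ : (∀ v : T.V, v ∈ T.Vbad → Set (S.L.StarPacket v)) → ∀ (j : T.Label) (vQ : T.VQ), Set (S.L.Packet j vQ))
  (qK : ∀ v : T.V, v ∈ T.Vbad → Set (S.L.StarPacket v))

/-- **The maximal reading forces the packetwise Θ/q VOLUME IDENTITY.** Pins + `D3.IndIsometric` + admissible (Ind3)-enlarged Θ-regions +
`Thm311Charitable_3` ⊢ in every packet `logvol (ρ qK) = logvol (ρ Ψ_n)` (abc-iut-w4-d021 `candidate_forces_equal_volumes` applied to the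
candidate `Thm311Charitable_3`, which is (T-a)-sufficient by p431653; Thm. 3.11 (ii)(b) for column `n` from the reading's frozen `partII`).
[claim: Mochizuki2012, status: disputed] -/
theorem charitable_3_forces_equal_volumes (hpin : PinnedRegions3 S P ρ qK) (hIso : D3.IndIsometric S)
    (hθ : ∀ (j : T.Label) (vQ : T.VQ), (S.D P.n).Adm j vQ (P.thetaRegion3 j vQ))
    (hC : Summit.ABC.IUTFork.Charitable.Thm311Charitable_3 S P ρ qK) (j : T.Label) (vQ : T.VQ) :
    (S.D P.n).logvol j vQ (ρ qK j vQ) = (S.D P.n).logvol j vQ (ρ (S.D P.n).Ψ j vQ) := by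
  obtain ⟨X, hX⟩ := hC
  exact candidate_forces_equal_volumes (fun S P ρ qK => Thm311Charitable_3 S P ρ qK) S P ρ qK
    (fun _ _ h => by
      obtain ⟨Y, hY⟩ := h
      exact D3Kit.s_of_qK_eq_psi_of_mem_RLGP S P ρ qK (D3.ipl_at_pilot S P Y qK hY.ipl hY.she hY.qDatum)) (hX.partII P.n).2.1 hpin (hIso P.n).1 (hIso P.n).2 hθ ⟨X, hX⟩ j vQ

/-- **The same on the printed local quantities**: under the pins, `D3.IndIsometric`, admissible Θ-regions and the maximal reading, the
q-pilot's local log-volume `qLocal j v_ℚ` (Cor. 3.12 p. 174 l. 5–9) EQUALS the log-volume of the (Ind3)-enlarged Θ-pilot region `thetaRegion3 j v_ℚ`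
(p. 174 l. 2–4) in every packet. [claim: Mochizuki2012, status: disputed] -/
theorem charitable_3_qLocal_eq (hpin : PinnedRegions3 S P ρ qK) (hIso : D3.IndIsometric S)
    (hθ : ∀ (j : T.Label) (vQ : T.VQ), (S.D P.n).Adm j vQ (P.thetaRegion3 j vQ))
    (hC : Summit.ABC.IUTFork.Charitable.Thm311Charitable_3 S P ρ qK) (j : T.Label) (vQ : T.VQ) :
    P.qLocal j vQ = (S.D P.n).logvol j vQ (P.thetaRegion3 j vQ) := by
  obtain ⟨X, hX⟩ := hC
  have hKumB : (S.col P.n).KummerB (S.D P.n) := (hX.partII P.n).2.1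
  have h := charitable_3_forces_equal_volumes S P ρ qK hpin hIso hθ ⟨X, hX⟩ j vQ
  unfold Setting.qLocal
  rw [hpin.1.2 j vQ, thetaRegion3_eq_of_thetaPinned S P ρ hKumB hpin.1.1 j vQ]
  exact h

end Summit.ABC.IUTFork.Charitable.D3DeriveVolumes

end
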